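import Literature.AlgebraicGeometry.ShimuraVarieties.UnitaryAuxiliaryTorusDatum
import HarnessLib

/-!
# Bookkeeping for the reflex field `E♯ = τ(L)·E*(Φ)` of the auxiliary datum `(G × T₀, X × {h_Φ})`
# (Liu 2021 App. C Lem. C.14 / Rem. C.15; Shimura 1998 §8.3 Prop. 28)

Topic `AlgebraicGeometry/ShimuraVarieties`; namespace `Literature.AlgebraicGeometry.ShimuraVarieties`, grouping
sub-namespace `UnitaryCanonicalModel.Aux` (the carriers of `UnitaryAuxiliaryTorusDatum`).  THEOREMS ONLY (no definition,
no named fact, no instance): the three pieces of field bookkeeping that every consumer of the named fact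
`Aux.canonicalModel_exists_printed` (F1, Deligne 1979 2.3.1 read on the auxiliary datum) needs before it can speak:

* `Aux.exists_isAdapted` — **adapted CM types exist**: for every complex embedding `τ` of the CM field `L` there is
  a CM type `Φ ∋ τ` (choose `τ` in its conjugate pair and any member of every other pair; `L` is totally complex, so
  no embedding is self-conjugate).  This is the non-vacuity of the binder `IsAdapted L Φ τ` of F1
  ([Liu2021] §C.3 p. 113: «Let `Φ` be a CM type containing `τ`»; [Deligne1979ShimuraVarieties] 2.3.1).
* `Aux.hasSmallReflex_of_isGalois` / `Aux.reflexField_eq_fieldRange_of_isGalois` — **for `L/ℚ` Galois the reflex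
  field is small**, `E*(Φ) ⊆ τ(L)` and `E♯ = τ(L)` ([Shimura1998] §8.3 Prop. 28: `K* ⊆` every Galois field containing
  `K`; the tree's `ComplexMultiplication.traceField_le_fieldRange`; [Liu2021] Rem. C.15 for the failure in general).
* `Aux.coe_reflexField_subset_range` / `Aux.exists_ringHom_reflexField` — **`E♯` embeds in every subfield of `ℂ`
  containing `τ(L)` and `E*(Φ)`**: if `ιE : E →+* ℂ` has `τ(L) ⊆ ιE(E) ⊇ E*(Φ)` then `E♯ ⊆ ιE(E)` and there is a ring
  homomorphism `j : E♯ →+* E` with `ιE ∘ j = (E♯ ⊂ ℂ)` — the base-change map along which an `E♯`-form of the Shimura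
  variety becomes an `E`-form (consumer: the hodgecm-mathlib a1-skeleton stub `stub_reflexCompositumModel`, whose
  hypotheses are exactly `Set.range τ ⊆ Set.range ιE` and `traceField Φ ⊆ Set.range ιE`).

Cell hodgecm-mathlib (D-0151), fan A, KEY a1-reflex-compositum-model piece (i).  HC_CM is proved only modulo the 7
printed citations until rung 0 closes; nothing here touches them.

References: [Liu2021] Y. Liu, Camb. J. Math. 9 (2021), App. C §C.3 p. 113 (Lem. C.14, Rem. C.15);
[Shimura1998] G. Shimura, *Abelian Varieties with Complex Multiplication and Modular Functions* (1998), §8.3 Prop. 28;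
[Deligne1979ShimuraVarieties] P. Deligne, *Variétés de Shimura* (1979), 2.3.1.
-/

noncomputable section

open NumberField
open Literature.AlgebraicGeometry.Motives (CMType)
open Literature.NumberTheory.ComplexMultiplication (traceField traceField_le_fieldRange)

namespace Literature.AlgebraicGeometry.ShimuraVarieties

namespace UnitaryCanonicalModel

namespace Aux

variable (L : Type) [Field L] [NumberField L]

/-! ### §1. Adapted CM types exist -/

/-- **Every complex embedding of a CM field lies in a CM type**: for `τ : L →+* ℂ` there is `Φ : CMType L` adapted to
the unitary datum at `τ` (`IsAdapted L Φ τ`, i.e. `τ ∈ Φ`).  Proof: `L` is totally complex, so `φ ↦ φ̄` has no fixed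
point; take `τ` in the place of `τ` and the distinguished embedding `w.embedding` at every other infinite place `w`.
[cite: Liu2021, App. C §C.3 p. 113 («a CM type Φ containing τ»)] -/
theorem exists_isAdapted [IsCMField L] (τ : L →+* ℂ) : ∃ Φ : CMType L, IsAdapted L Φ τ := by
  classical
  -- the candidate set of embeddings: `τ` at the place of `τ`, the distinguished embedding elsewhere
  let S : Set (L →+* ℂ) := {φ | (InfinitePlace.mk φ = InfinitePlace.mk τ → φ = τ) ∧
    (InfinitePlace.mk φ ≠ InfinitePlace.mk τ → φ = (InfinitePlace.mk φ).embedding)}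
  have hnc : ∀ φ : L →+* ℂ, ComplexEmbedding.conjugate φ ≠ φ := fun φ h =>
    IsTotallyComplex.complexEmbedding_not_isReal φ (ComplexEmbedding.isReal_iff.2 h)
  have hS : ∀ φ : L →+* ℂ, φ ∈ S ↔ ComplexEmbedding.conjugate φ ∉ S := by
    intro φ
    have hmk : InfinitePlace.mk (ComplexEmbedding.conjugate φ) = InfinitePlace.mk φ :=
      InfinitePlace.mk_conjugate_eq φ
    by_cases h : InfinitePlace.mk φ = InfinitePlace.mk τ
    · -- the place of `τ`: `φ ∈ S ↔ φ = τ`, `φ̄ ∈ S ↔ φ̄ = τ`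
      have hφ : φ ∈ S ↔ φ = τ := ⟨fun hm => hm.1 h, fun he => ⟨fun _ => he, fun hn => (hn h).elim⟩⟩
      have hφ' : ComplexEmbedding.conjugate φ ∈ S ↔ ComplexEmbedding.conjugate φ = τ := by
        change ((InfinitePlace.mk (ComplexEmbedding.conjugate φ) = InfinitePlace.mk τ → _) ∧
          (InfinitePlace.mk (ComplexEmbedding.conjugate φ) ≠ InfinitePlace.mk τ → _)) ↔ _
        rw [hmk]
        exact ⟨fun hm => hm.1 h, fun he => ⟨fun _ => he, fun hn => (hn h).elim⟩⟩
      rw [hφ, hφ']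
      refine ⟨fun he hc => hnc τ ?_, fun hc => ?_⟩
      · rw [he] at hc
        exact hc
      · rcases InfinitePlace.mk_eq_iff.1 h with h1 | h1
        · exact h1
        · exact (hc h1).elim
    · -- another place `w = mk φ`: `φ ∈ S ↔ φ = w.embedding`
      set ψ := (InfinitePlace.mk φ).embedding with hψ
      have hφ : φ ∈ S ↔ φ = ψ := ⟨fun hm => hm.2 h, fun he => ⟨fun hc => (h hc).elim, fun _ => he⟩⟩
      have hφ' : ComplexEmbedding.conjugate φ ∈ S ↔ ComplexEmbedding.conjugate φ = ψ := by
        change ((InfinitePlace.mk (ComplexEmbedding.conjugate φ) = InfinitePlace.mk τ → _) ∧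
          (InfinitePlace.mk (ComplexEmbedding.conjugate φ) ≠ InfinitePlace.mk τ →
            ComplexEmbedding.conjugate φ = (InfinitePlace.mk (ComplexEmbedding.conjugate φ)).embedding)) ↔ _
        rw [hmk]
        exact ⟨fun hm => hm.2 h, fun he => ⟨fun hc => (h hc).elim, fun _ => he⟩⟩
      rw [hφ, hφ']
      have hmkψ : InfinitePlace.mk φ = InfinitePlace.mk ψ := (InfinitePlace.mk_embedding _).symm
      refine ⟨fun he hc => hnc φ (hc.trans he.symm), fun hc => ?_⟩
      rcases InfinitePlace.mk_eq_iff.1 hmkψ with h1 | h1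
      · exact h1
      · exact (hc h1).elim
  refine ⟨⟨S, hS⟩, ?_⟩
  change τ ∈ S
  exact ⟨fun _ => rfl, fun hn => (hn rfl).elim⟩

/-! ### §2. Galois `L`: the reflex field is small -/

/-- **`E*(Φ) ⊆ τ(L)` for `L/ℚ` Galois** (`HasSmallReflex`): the trace field of a CM type lies in every Galois subfield of
`ℂ` receiving `L` — the tree's `traceField_le_fieldRange` at `j = id`. [cite: Shimura1998, §8.3 Prop. 28] -/
theorem hasSmallReflex_of_isGalois [IsGalois ℚ L] (Φ : CMType L) (τ : L →+* ℂ) : HasSmallReflex L Φ τ :=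
  traceField_le_fieldRange (AlgHom.id ℚ L) τ Φ

/-- **`E♯ = τ(L)` for `L/ℚ` Galois** (as intermediate fields of `ℂ/ℚ`). [cite: Shimura1998, §8.3 Prop. 28]
[cite: Liu2021, App. C Rem. C.15 (p. 113)] -/
theorem reflexField_eq_fieldRange_of_isGalois [IsGalois ℚ L] (Φ : CMType L) (τ : L →+* ℂ) :
    reflexField L Φ τ = τ.toRatAlgHom.fieldRange :=
  reflexField_eq_of_hasSmallReflex L (hasSmallReflex_of_isGalois L Φ τ)

/-- Under `HasSmallReflex` every element of `E♯` is a value of `τ`. [cite: Liu2021, App. C Rem. C.15 (p. 113)] -/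
theorem exists_apply_eq_of_hasSmallReflex {Φ : CMType L} {τ : L →+* ℂ} (h : HasSmallReflex L Φ τ)
    (x : ↥(reflexField L Φ τ)) : ∃ y : L, τ y = x := by
  have hx : (x : ℂ) ∈ τ.toRatAlgHom.fieldRange := by
    rw [← reflexField_eq_of_hasSmallReflex L h]; exact x.2
  obtain ⟨y, hy⟩ := AlgHom.mem_fieldRange.1 hx
  exact ⟨y, hy⟩

/-! ### §3. `E♯` inside any field containing `τ(L)` and `E*(Φ)` -/

variable {L}

/-- **`E♯ ⊆ ιE(E)` whenever `τ(L) ⊆ ιE(E) ⊇ E*(Φ)`** (the compositum is the smallest such field): the hypothesis shape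
of the a1-skeleton stub `stub_reflexCompositumModel`. [cite: Liu2021, App. C Lem. C.14 (p. 113)] -/
theorem coe_reflexField_subset_range (Φ : CMType L) (τ : L →+* ℂ) {E : Type*} [Field E] [CharZero E] (ιE : E →+* ℂ)
    (hτ : Set.range τ ⊆ Set.range ιE) (hΦ : (traceField Φ : Set ℂ) ⊆ Set.range ιE) :
    (reflexField L Φ τ : Set ℂ) ⊆ Set.range ιE := by
  have hle : reflexField L Φ τ ≤ ιE.toRatAlgHom.fieldRange := by
    refine sup_le ?_ ?_
    · rintro x hx
      obtain ⟨y, rfl⟩ := AlgHom.mem_fieldRange.1 hx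
      obtain ⟨z, hz⟩ := hτ ⟨y, rfl⟩
      exact AlgHom.mem_fieldRange.2 ⟨z, hz⟩
    · intro x hx
      obtain ⟨z, hz⟩ := hΦ hx
      exact AlgHom.mem_fieldRange.2 ⟨z, hz⟩
  intro x hx
  obtain ⟨z, hz⟩ := AlgHom.mem_fieldRange.1 (hle hx)
  exact ⟨z, hz⟩

/-- **The embedding `j : E♯ →+* E` with `ιE ∘ j = (E♯ ⊂ ℂ)`** for `τ(L) ⊆ ιE(E) ⊇ E*(Φ)`: the ring homomorphism along
which an `E♯`-scheme is base-changed to `E` compatibly with the complex fibres (`ιE ∘ j` is the inclusion, so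
`(X ⊗_{E♯,j} E) ⊗_{E,ιE} ℂ ≅ X ⊗_{E♯} ℂ`).  Stated as an existence (`ιE` is injective, so `j` is unique).
[cite: Liu2021, App. C Lem. C.14 (p. 113)] -/
theorem exists_ringHom_reflexField (Φ : CMType L) (τ : L →+* ℂ) {E : Type*} [Field E] [CharZero E] (ιE : E →+* ℂ)
    (hτ : Set.range τ ⊆ Set.range ιE) (hΦ : (traceField Φ : Set ℂ) ⊆ Set.range ιE) :
    ∃ j : ↥(reflexField L Φ τ) →+* E, ∀ x : ↥(reflexField L Φ τ), ιE (j x) = x := by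
  classical
  have h := coe_reflexField_subset_range Φ τ ιE hτ hΦ
  choose f hf using fun x : ↥(reflexField L Φ τ) => h x.2
  refine ⟨{ toFun := f
            map_one' := ιE.injective (by rw [hf, map_one]; rfl)
            map_mul' := fun x y => ιE.injective (by rw [hf, map_mul, hf, hf]; rfl)
            map_zero' := ιE.injective (by rw [hf, map_zero]; rfl)
            map_add' := fun x y => ιE.injective (by rw [hf, map_add, hf, hf]; rfl) }, fun x => hf x⟩

/-- The embedding `j : E♯ →+* E` restricted along `τ`: `ιE (j (τ x)) = τ x`, i.e. `ιE ∘ j ∘ toReflexField = τ`.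
[cite: Liu2021, App. C Lem. C.14 (p. 113)] -/
theorem exists_ringHom_reflexField_comp (Φ : CMType L) (τ : L →+* ℂ) {E : Type*} [Field E] [CharZero E]
    (ιE : E →+* ℂ) (hτ : Set.range τ ⊆ Set.range ιE) (hΦ : (traceField Φ : Set ℂ) ⊆ Set.range ιE) :
    ∃ j : ↥(reflexField L Φ τ) →+* E, (∀ x : ↥(reflexField L Φ τ), ιE (j x) = x) ∧
      ιE.comp (j.comp (toReflexField L Φ τ)) = τ := by
  obtain ⟨j, hj⟩ := exists_ringHom_reflexField Φ τ ιE hτ hΦ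
  exact ⟨j, hj, RingHom.ext fun x => by rw [RingHom.comp_apply, RingHom.comp_apply, hj, coe_toReflexField_apply]⟩

end Aux

end UnitaryCanonicalModel

end Literature.AlgebraicGeometry.ShimuraVarieties

end
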